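import Summits.QuantumFields.YangMills.Theorems.BalabanUVNodesK0Stub3V20CurrencyRoads
import Summits.QuantumFields.YangMills.Theorems.BalabanUVNodesK0Stub3V20ComparabilitySockets
import Summits.QuantumFields.YangMills.Theorems.BalabanUVNodesK0PrintCubeOfStepTokensGuarded

/-!
# K0⁷ — STUB 3 UNDER THE V20 TEXTS, PART 5: the G-SIDE HUB — K0⁷ BY NAME under the plan's V20-G STUB-1 TEXT (`stub_prop8StepCoPG13`, WORD V20 = G I.37134) from every stub-3 box
# currency: 3ᴬ′-G♭ ∕ 3ᴬ′-G, the token-free core, the two road schemas, the three one-witness kernel-level bills (through k0-s1-w3 g7's G composition `record13SepCoPHBody_of_stubs1G_2P_3A'G`,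
# stub 2′ BY NAME p595104), AND from the run-wise ∕ comparability letters 3ᴿ-G♭ ∕ 3ᶜ-G♭ and their token-free cores (G closer p635083 + guarded print-cube supplier + p607023 ∕ p609606)

Cell `pub-ymgap`, width seat `pub-ymgap-k0-s3-w2` (g3; director-ym R399 (3a) ∕ №207; bus CLAIM-5 = this file).  `--kind proof --supports stmt-QuantumFields-20541 --as helper` (count-neutral).
NEW leaf; theorems only; 0 `def`; nothing modified; no registry write.  Imports `…K0Stub3V20CurrencyRoads` (p634760) + `…K0Stub3V20ComparabilitySockets` (p635649) (this seat) and `…K0PrintCubeOfStepTokensGuarded` (k0-s1-w3 g7,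
the V20-G three-stub composition, over `…K0AllTorusOfStepTokensGuarded` p635083 and dag-n07-e g21's modules 53∕54 p630551 ∕ p632171).  [15] = [Balaban1985Variational]; [6] = [Balaban1985RegularSpaces];
[I] = [Balaban1987RG1]; [II] = [Balaban1989LargeFieldII]; [III] = [Balaban1988Convergent].

WHY.  Plan g86's WORD V20 = G re-texts BOTH active stubs of K0⁷: stub 1 becomes `Prop8StepCoPGAt F := ∃ (c c₀ : ℕ) (B₃ a₀ a₁ : ℝ), 2·(F.L)² ≤ B₃ ∧ 0 < a₀ ∧ 0 < a₁ ∧ Prop8RegSepTopStepG F 2 suppDom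
(fun ν _M _g K k _s => c ≤ ν.M₁ ∧ k + c₀ ≤ F.m + K) B₃ a₀ a₁`, stub 3 the guarded 3ᴬ′; the V20-G skeleton's composition is k0-s1-w3 g7's `record13SepCoPHBody_of_stubs1G_2P_3A'G` (3ᴬ′-G♭, the text
WITH the located binder `c₀ ≤ j + 1`, I.37256) ∕ `…_3A'Gstrong` (binder-free).  FILES 1–4 of this seat (p632040 · p633384 · p634760 · p635649) gave the stub-3 side: every currency ⟹ the token-free core ⟹
every text, and K0⁷ BY NAME under the V20-R and V19 stub-1 texts.  Plan g86's INTENT-V20G (dead8a8df885c226, bus 13:22Z) registers EXACTLY the G♭ letters as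
`AbsBetaBoxAtThm1WitnessCCMGenGAt` (binders `(j c c₀)`, riders `c ≤ F.L ^ j`, `c₀ ≤ j + 1`).  THIS FILE closes the square on the G side: under the V20-G STUB-1 TEXT, K0⁷ BY NAME from (§1) 3ᴬ′-G♭ (= the V20-G skeleton's
by-name closer: composition ∘ `K0V19Stub2Prime.stub_prop6MemberB8AtP13`), the plan's binder-free 3ᴬ′-G (`…V20Sockets.abs3A'Gb_of_abs3A'G`), the TOKEN-FREE box core (`abs3A'G_of_tokenFree`), (§2) the
two road schemas (`tokenFree_of_genericRoadAtWindowWitness` p632040, `tokenFree_of_genericRoadAtWitness` p633384), (§3) the one-witness kernel-letter ∕ (5.10)-window-uniform ∕ fundamental-domain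
bills (p634760); (§4) the G-body at `(L^j, c, c₀)` from ONE run ∕ comparability letter (token-free clause lemmas `clausesH_of_runAbsBox` p607023 ∕ `clausesH_of_twoComparable` p609606 + the G closer
p635083, which needs the located binder `c₀ ≤ j + 1`); (§5) the guarded-supplier compositions (k0-s1-w3's `…_of_gauge9SupplierG_of_absBetaBoxAtG` pattern with runs ∕ comparability); (§6) K0⁷ BY
NAME from 3ᴿ-G♭, 3ᶜ-G♭ and the token-free run ∕ comparability cores.  So on V20-G's registration day every NODE O road of the lane closes K0⁷ by ONE `exact`, given a by-name proof of
`stub_prop8StepCoPG13`.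

HONEST FRAMING.  One-line compositions BY NAME; NO β estimate; nothing of Bałaban asserted; the V20-G stub-1 text and every stub-3 letter below are HYPOTHESES inhabited nowhere; 3ᴬ′ (any
text), 3ᴿ, 3ᶜ NOT proved — NODE O's wall ([I] §1 p.264 «uniformly bounded» STATED, proof unpublished [II] p.355; ref-H NOTE-331b on 3ᶜ's vacuity stands); K0⁷ stmt-QuantumFields-20541 OPEN (V19 STANDS; the V20-G registration is the plan's act,
director №216 (iii)); counts unmoved (typed 28∕28 · discharged 5∕27, A 5∕28 — the chair's words).  One finite 𝕋⁴ programme at fixed `ε = L^{−K}`, Bałaban AS PRINTED — NOT continuum ∕ ℝ⁴ ∕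
OS ∕ mass gap ∕ Clay (the Yang–Mills mass gap is NOT proved by any of this; route R4 closes the CONDITIONAL finite-𝕋⁴ rung `BalabanLadder.UV` only).  No `sorry`, `def`, `instance`, `notation`, `axiom`.
-/

noncomputable section

open scoped Matrix.Norms.L2Operator

namespace Summit.QuantumFields.YangMills.Theorems.K0Stub3V20GSockets

open Literature.MathematicalPhysics.QuantumFieldTheory.Balaban1983to89
open Literature.MathematicalPhysics.QuantumFieldTheory.Balaban1983to89.Node00
open Literature.MathematicalPhysics.QuantumFieldTheory.Balaban1983to89.T4Continuum
open Literature.MathematicalPhysics.QuantumFieldTheory.Balaban1983to89.FlowStep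
open Literature.MathematicalPhysics.QuantumFieldTheory.Balaban1983to89.T4OutputRate (Window NE9)
open Literature.MathematicalPhysics.QuantumFieldTheory.Balaban1983to89.B12Sec2to5 (l1 Decay510)
open Literature.MathematicalPhysics.QuantumFieldTheory.Balaban1983to89.Node00.U3OfKernels (kernelA objectsOfRecord₁₃ KernelDecayOfRecord₁₃)
open Literature.MathematicalPhysics.QuantumFieldTheory.Balaban1983to89.Node00.U3KernelLetters (PolLimitsExistBox)
open Summit.QuantumFields.YangMills.Theorems.K0V19Stub2Prime (stub_prop6MemberB8AtP13)
open Summit.QuantumFields.YangMills.Theorems.K0Stub3V20Sockets (abs3A'G_of_tokenFree abs3A'Gb_of_abs3A'G tokenFree_of_genericRoadAtWindowWitness)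
open Summit.QuantumFields.YangMills.Theorems.K0Stub3V20RunSockets (tokenFree_of_genericRoadAtWitness)
open Summit.QuantumFields.YangMills.Theorems.K0Stub3V20CurrencyRoads (tokenFree_of_kernelLettersAtOneWitness tokenFree_of_kernelLettersAtOneWindowWitness
  tokenFree_of_kernelDecayWindowUniformAtOneWitness tokenFree_of_fundamentalDomainFaceAtOneWitness)
open Summit.QuantumFields.YangMills.Theorems.BalabanUVNodesK2NamedJetsRunRemAt (RunConstRemainder)
open Summit.QuantumFields.YangMills.Theorems.K0Stub3RunwiseFace (clausesH_of_runAbsBox)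
open Summit.QuantumFields.YangMills.Theorems.K0Stub3ComparabilityFace (clausesH_of_twoComparable)
open Summit.QuantumFields.YangMills.BalabanUVNodes.N07Thm1Top7FromProp8 (variationalThm1RegSepCoP7MG_of_prop8TopStepG)
open Summit.QuantumFields.YangMills.Theorems.K0AllTorusOfStepTokensGuarded (exists_k0SepCoPH_thm1CCMW_of_thm1RegSepCoP7MG_of_gauge9TopStepG_of_hcomp_allTorus)
open Summit.QuantumFields.YangMills.Theorems.K0PrintCubeOfStepTokensGuarded (record13SepCoPHBody_of_stubs1G_2P_3A'G gauge9SupplierG_of_prop6MemberP)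

/-! ## §1  K0⁷ BY NAME under the V20-G stub-1 text from the guarded box texts and the token-free core -/

section Texts


/-- **★ THE TOKEN-FREE CORE PAYS THE REGISTERED V20-G 3ᴬ′ TEXT `AbsBetaBoxAtThm1WitnessCCMGenGAt F`** (plan g86 INTENT-V20G dead8a8df885c226: binders `(j c c₀)`, riders `c ≤ F.L ^ j`, `c₀ ≤ j + 1`,
both antecedents guarded = p632040's `h3Gb` LETTER FOR LETTER) — in one name: `abs3A'G_of_tokenFree` then `abs3A'Gb_of_abs3A'G`.  So a by-name proof of `stub_absBetaBoxAtThm1WitnessCCMGenG13` is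
`fun F => abs3A'Gb_of_tokenFree F (hT F)` away from ONE sign-free box of `β₁₃(F; a₀, ε₂₉)` per threshold.  CONDITIONAL; nothing asserted.
[cite: Balaban1987RG1, Thm 1 p.259, §1 (1.20)–(1.22) p.264, (0.1) p.251; Balaban1985Variational, Thm 1 (8)–(9) p.279, p.304 lines 1–2; Balaban1989LargeFieldII, p.355] -/
theorem abs3A'Gb_of_tokenFree (F : T4Family)
    (hT : ∀ a₀ : ℝ, 0 < a₀ → ∃ γ₀ ε₂₉ β' : ℝ, 0 < γ₀ ∧ 0 < ε₂₉ ∧ ∀ (j : ℕ) (ε₀ B₃ B₃' a₁ : ℝ),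
      BetaLowerH (-β') γ₀ (betaOfRecord₁₃ F 2 (theta13OfThm1CCM F 2 j ε₀ ε₂₉ B₃ B₃' a₀ a₁)) ∧
      BetaUpperH β' γ₀ (betaOfRecord₁₃ F 2 (theta13OfThm1CCM F 2 j ε₀ ε₂₉ B₃ B₃' a₀ a₁))) :
    ∀ (j c c₀ : ℕ) (B₃ B₃' a₀ a₁ : ℝ), c ≤ F.L ^ j → c₀ ≤ j + 1 → 2 * (F.L : ℝ) ^ 2 ≤ B₃ → 0 < B₃' → 0 < a₀ → 0 < a₁ →
      VariationalThm1RegSepCoP7MG F 2 (fun ν _M _g K k _s => c ≤ ν.M₁ ∧ k + c₀ ≤ F.m + K) B₃ a₀ a₁ →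
      Gauge9RegSepTopStepG F 2 (fun ν K Ω => suppDomOfRecord F ν K Ω) (F.L ^ j) (fun ν _M _g K k _s => c ≤ ν.M₁ ∧ k + c₀ ≤ F.m + K) B₃ B₃' a₀ a₁ →
      ∃ γ₀ ε₀ ε₂₉ β' : ℝ, 0 < γ₀ ∧ 0 < ε₀ ∧ 0 < ε₂₉ ∧
        BetaLowerH (-β') γ₀ (betaOfRecord₁₃ F 2 (theta13OfThm1CCM F 2 j ε₀ ε₂₉ B₃ B₃' a₀ a₁)) ∧
        BetaUpperH β' γ₀ (betaOfRecord₁₃ F 2 (theta13OfThm1CCM F 2 j ε₀ ε₂₉ B₃ B₃' a₀ a₁)) :=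
  abs3A'Gb_of_abs3A'G F (abs3A'G_of_tokenFree F hT)

/-- **★★★ THE V20-G SKELETON's BY-NAME CLOSER: K0⁷ FROM THE V20-G STUB-1 TEXT AND 3ᴬ′-G♭** (k0-s1-w3 g7's `record13SepCoPHBody_of_stubs1G_2P_3A'G` with stub 2′ BY NAME,
`K0V19Stub2Prime.stub_prop6MemberB8AtP13` p595104; 3ᴬ′-G♭ = the guarded text WITH the located binder `c₀ ≤ j + 1`).  CONDITIONAL on both texts (displayed, NOT proved here — they are the two
stubs the V20-G skeleton registers); K0⁷ OPEN; a helper, not a closer. [cite: Balaban1985Variational, Thm 1 (8)–(9) p.279, (144)–(152) pp.300–301, Prop. 8 p.304, p.304 lines 1–2; Balaban1985RegularSpaces, (1.3)–(1.6) p.77, Prop. 6 p.99, p.98; Balaban1988Convergent, Thm 1 p.262, (2.6)–(2.8) pp.255–256; Balaban1987RG1, Thm 1 p.259, §1 p.264, (0.1) p.251] -/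
theorem record13SepCoPHInhabited_of_stub1G_abs3A'Gb_byName
    (h1G : ∀ F : T4Family, ∃ (c c₀ : ℕ) (B₃ a₀ a₁ : ℝ), 2 * (F.L : ℝ) ^ 2 ≤ B₃ ∧ 0 < a₀ ∧ 0 < a₁ ∧
      Prop8RegSepTopStepG F 2 (fun ν K Ω => suppDomOfRecord F ν K Ω) (fun ν _M _g K k _s => c ≤ ν.M₁ ∧ k + c₀ ≤ F.m + K) B₃ a₀ a₁)
    (h3Gb : ∀ (F : T4Family) (j c c₀ : ℕ) (B₃ B₃' a₀ a₁ : ℝ), c ≤ F.L ^ j → c₀ ≤ j + 1 → 2 * (F.L : ℝ) ^ 2 ≤ B₃ → 0 < B₃' → 0 < a₀ → 0 < a₁ →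
      VariationalThm1RegSepCoP7MG F 2 (fun ν _M _g K k _s => c ≤ ν.M₁ ∧ k + c₀ ≤ F.m + K) B₃ a₀ a₁ →
      Gauge9RegSepTopStepG F 2 (fun ν K Ω => suppDomOfRecord F ν K Ω) (F.L ^ j) (fun ν _M _g K k _s => c ≤ ν.M₁ ∧ k + c₀ ≤ F.m + K) B₃ B₃' a₀ a₁ →
      ∃ γ₀ ε₀ ε₂₉ β' : ℝ, 0 < γ₀ ∧ 0 < ε₀ ∧ 0 < ε₂₉ ∧
        BetaLowerH (-β') γ₀ (betaOfRecord₁₃ F 2 (theta13OfThm1CCM F 2 j ε₀ ε₂₉ B₃ B₃' a₀ a₁)) ∧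
        BetaUpperH β' γ₀ (betaOfRecord₁₃ F 2 (theta13OfThm1CCM F 2 j ε₀ ε₂₉ B₃ B₃' a₀ a₁))) :
    Summit.QuantumFields.YangMills.Theses.BalabanUVNodes.Record13SepCoPHInhabited :=
  record13SepCoPHBody_of_stubs1G_2P_3A'G h1G stub_prop6MemberB8AtP13 h3Gb

/-- **★★ K0⁷ BY NAME FROM THE V20-G STUB-1 TEXT AND THE PLAN's BINDER-FREE 3ᴬ′-G** (`…V20Sockets.abs3A'Gb_of_abs3A'G`: the binder-free text is the stronger stub).  CONDITIONAL on both
texts; K0⁷ OPEN; a helper, not a closer. [cite: Balaban1985Variational, Thm 1 (8)–(9) p.279, Prop. 8 p.304, p.304 lines 1–2; Balaban1985RegularSpaces, Prop. 6 p.99; Balaban1988Convergent, Thm 1 p.262; Balaban1987RG1, Thm 1 p.259, §1 p.264, (0.1) p.251] -/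
theorem record13SepCoPHInhabited_of_stub1G_abs3A'G_byName
    (h1G : ∀ F : T4Family, ∃ (c c₀ : ℕ) (B₃ a₀ a₁ : ℝ), 2 * (F.L : ℝ) ^ 2 ≤ B₃ ∧ 0 < a₀ ∧ 0 < a₁ ∧
      Prop8RegSepTopStepG F 2 (fun ν K Ω => suppDomOfRecord F ν K Ω) (fun ν _M _g K k _s => c ≤ ν.M₁ ∧ k + c₀ ≤ F.m + K) B₃ a₀ a₁)
    (h3G : ∀ (F : T4Family) (j c c₀ : ℕ) (B₃ B₃' a₀ a₁ : ℝ), c ≤ F.L ^ j → 2 * (F.L : ℝ) ^ 2 ≤ B₃ → 0 < B₃' → 0 < a₀ → 0 < a₁ →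
      VariationalThm1RegSepCoP7MG F 2 (fun ν _M _g K k _s => c ≤ ν.M₁ ∧ k + c₀ ≤ F.m + K) B₃ a₀ a₁ →
      Gauge9RegSepTopStepG F 2 (fun ν K Ω => suppDomOfRecord F ν K Ω) (F.L ^ j) (fun ν _M _g K k _s => c ≤ ν.M₁ ∧ k + c₀ ≤ F.m + K) B₃ B₃' a₀ a₁ →
      ∃ γ₀ ε₀ ε₂₉ β' : ℝ, 0 < γ₀ ∧ 0 < ε₀ ∧ 0 < ε₂₉ ∧
        BetaLowerH (-β') γ₀ (betaOfRecord₁₃ F 2 (theta13OfThm1CCM F 2 j ε₀ ε₂₉ B₃ B₃' a₀ a₁)) ∧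
        BetaUpperH β' γ₀ (betaOfRecord₁₃ F 2 (theta13OfThm1CCM F 2 j ε₀ ε₂₉ B₃ B₃' a₀ a₁))) :
    Summit.QuantumFields.YangMills.Theses.BalabanUVNodes.Record13SepCoPHInhabited :=
  record13SepCoPHInhabited_of_stub1G_abs3A'Gb_byName h1G fun F => abs3A'Gb_of_abs3A'G F (h3G F)

/-- **★★★ K0⁷ BY NAME FROM THE V20-G STUB-1 TEXT AND THE TOKEN-FREE BOX CORE** (ONE sign-free box of `β₁₃(F; a₀, ε₂₉)` per threshold — NODE O's text-independent bill; `…V20Sockets.abs3A'G_of_tokenFree`).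
CONDITIONAL; K0⁷ OPEN; a helper, not a closer. [cite: Balaban1985Variational, Thm 1 (8)–(9) p.279, Prop. 8 p.304, p.304 lines 1–2; Balaban1985RegularSpaces, Prop. 6 p.99; Balaban1988Convergent, Thm 1 p.262; Balaban1987RG1, Thm 1 p.259, §1 p.264; Balaban1989LargeFieldII, p.355] -/
theorem record13SepCoPHInhabited_of_stub1G_tokenFree_byName
    (h1G : ∀ F : T4Family, ∃ (c c₀ : ℕ) (B₃ a₀ a₁ : ℝ), 2 * (F.L : ℝ) ^ 2 ≤ B₃ ∧ 0 < a₀ ∧ 0 < a₁ ∧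
      Prop8RegSepTopStepG F 2 (fun ν K Ω => suppDomOfRecord F ν K Ω) (fun ν _M _g K k _s => c ≤ ν.M₁ ∧ k + c₀ ≤ F.m + K) B₃ a₀ a₁)
    (hT : ∀ (F : T4Family) (a₀ : ℝ), 0 < a₀ → ∃ γ₀ ε₂₉ β' : ℝ, 0 < γ₀ ∧ 0 < ε₂₉ ∧ ∀ (j : ℕ) (ε₀ B₃ B₃' a₁ : ℝ),
      BetaLowerH (-β') γ₀ (betaOfRecord₁₃ F 2 (theta13OfThm1CCM F 2 j ε₀ ε₂₉ B₃ B₃' a₀ a₁)) ∧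
      BetaUpperH β' γ₀ (betaOfRecord₁₃ F 2 (theta13OfThm1CCM F 2 j ε₀ ε₂₉ B₃ B₃' a₀ a₁))) :
    Summit.QuantumFields.YangMills.Theses.BalabanUVNodes.Record13SepCoPHInhabited :=
  record13SepCoPHInhabited_of_stub1G_abs3A'G_byName h1G fun F => abs3A'G_of_tokenFree F (hT F)

end Texts

/-! ## §2  K0⁷ BY NAME under the V20-G stub-1 text from the two ROAD SCHEMAS (any θ-generic box road at ONE witness per threshold) -/

section Schemas

/-- **★★ K0⁷ BY NAME FROM THE V20-G STUB-1 TEXT AND ANY θ-GENERIC OWN-WINDOW BOX ROAD INHABITED AT ONE SMALL-WINDOW WITNESS PER THRESHOLD** (p632040's `tokenFree_of_genericRoadAtWindowWitness`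
per family).  CONDITIONAL on `h1G`, the roads and their packages `P F` (displayed, inhabited nowhere); K0⁷ OPEN; a helper, not a closer.
[cite: Balaban1985Variational, Thm 1 (8)–(9) p.279, Prop. 8 p.304; Balaban1985RegularSpaces, Prop. 6 p.99; Balaban1988Convergent, Thm 1 p.262; Balaban1987RG1, Thm 1 p.255, §1 p.264, (5.10) p.293; Balaban1989LargeFieldII, (1.4) p.357] -/
theorem record13SepCoPHInhabited_of_stub1G_genericRoadAtWindowWitness_byName
    (h1G : ∀ F : T4Family, ∃ (c c₀ : ℕ) (B₃ a₀ a₁ : ℝ), 2 * (F.L : ℝ) ^ 2 ≤ B₃ ∧ 0 < a₀ ∧ 0 < a₁ ∧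
      Prop8RegSepTopStepG F 2 (fun ν K Ω => suppDomOfRecord F ν K Ω) (fun ν _M _g K k _s => c ≤ ν.M₁ ∧ k + c₀ ≤ F.m + K) B₃ a₀ a₁)
    (P : (F : T4Family) → Stage13Params F 2 → Prop)
    (hroad : ∀ (F : T4Family) (θ : Stage13Params F 2), P F θ → 0 < θ.γ →
      ∃ β' : ℝ, BetaLowerH (-β') θ.γ (betaOfRecord₁₃ F 2 θ) ∧ BetaUpperH β' θ.γ (betaOfRecord₁₃ F 2 θ))
    (hAt : ∀ (F : T4Family) (a₀ : ℝ), 0 < a₀ → ∃ (j : ℕ) (γ₀ ε₀ ε₂₉ B₃ B₃' a₁ : ℝ), 0 < γ₀ ∧ γ₀ ≤ 1 / 2 ∧ 0 < ε₂₉ ∧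
      P F (theta13OfThm1CCMW F 2 j γ₀ ε₀ ε₂₉ B₃ B₃' a₀ a₁)) :
    Summit.QuantumFields.YangMills.Theses.BalabanUVNodes.Record13SepCoPHInhabited :=
  record13SepCoPHInhabited_of_stub1G_tokenFree_byName h1G fun F => tokenFree_of_genericRoadAtWindowWitness F (P F) (hroad F) (hAt F)

/-- **★★ K0⁷ BY NAME FROM THE V20-G STUB-1 TEXT AND ANY θ-GENERIC SUB-WINDOW BOX ROAD INHABITED AT ONE OF A1's WITNESSES PER THRESHOLD** (p633384's `tokenFree_of_genericRoadAtWitness` per family).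
CONDITIONAL; K0⁷ OPEN; a helper, not a closer. [cite: Balaban1985Variational, Thm 1 (8)–(9) p.279, Prop. 8 p.304; Balaban1985RegularSpaces, Prop. 6 p.99; Balaban1988Convergent, Thm 1 p.262; Balaban1987RG1, Thm 1 p.255, §1 p.264, (5.10) p.293; Balaban1988RG2Cluster, Lemma 3 (2.38) p.20] -/
theorem record13SepCoPHInhabited_of_stub1G_genericRoadAtWitness_byName
    (h1G : ∀ F : T4Family, ∃ (c c₀ : ℕ) (B₃ a₀ a₁ : ℝ), 2 * (F.L : ℝ) ^ 2 ≤ B₃ ∧ 0 < a₀ ∧ 0 < a₁ ∧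
      Prop8RegSepTopStepG F 2 (fun ν K Ω => suppDomOfRecord F ν K Ω) (fun ν _M _g K k _s => c ≤ ν.M₁ ∧ k + c₀ ≤ F.m + K) B₃ a₀ a₁)
    (P : (F : T4Family) → Stage13Params F 2 → Prop)
    (hroad : ∀ (F : T4Family) (θ : Stage13Params F 2), P F θ →
      ∃ γ₀ β' : ℝ, 0 < γ₀ ∧ BetaLowerH (-β') γ₀ (betaOfRecord₁₃ F 2 θ) ∧ BetaUpperH β' γ₀ (betaOfRecord₁₃ F 2 θ))
    (hAt : ∀ (F : T4Family) (a₀ : ℝ), 0 < a₀ → ∃ (j : ℕ) (ε₀ ε₂₉ B₃ B₃' a₁ : ℝ), 0 < ε₂₉ ∧ P F (theta13OfThm1CCM F 2 j ε₀ ε₂₉ B₃ B₃' a₀ a₁)) :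
    Summit.QuantumFields.YangMills.Theses.BalabanUVNodes.Record13SepCoPHInhabited :=
  record13SepCoPHInhabited_of_stub1G_tokenFree_byName h1G fun F => tokenFree_of_genericRoadAtWitness F (P F) (hroad F) (hAt F)

end Schemas

/-! ## §3  K0⁷ BY NAME under the V20-G stub-1 text from the three kernel-level bills at ONE witness per threshold (p634760's roads) -/

section Currencies

/-- **★★ K0⁷ BY NAME FROM THE V20-G STUB-1 TEXT AND THE KERNEL-LETTER BILL AT ONE WITNESS PER THRESHOLD** (N22's `NE9` on the witness window + fading memory + (D4)'s `KernelDecayOfRecord₁₃`; p610322's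
package, p634760's `tokenFree_of_kernelLettersAtOneWitness`).  CONDITIONAL on `h1G` and the letters (displayed, inhabited nowhere); K0⁷ OPEN; a helper, not a closer.
[cite: Balaban1985Variational, Thm 1 (8)–(9) p.279, Prop. 8 p.304, p.304 lines 1–2; Balaban1985RegularSpaces, Prop. 6 p.99; Balaban1988Convergent, Thm 1 p.262; Balaban1987RG1, Thm 1 p.259, (1.18) p.263, (5.10) p.293; Balaban1988RG2Cluster, (2.13)–(2.14) pp.14–15] -/
theorem record13SepCoPHInhabited_of_stub1G_kernelLettersAtOneWitness_byName
    (h1G : ∀ F : T4Family, ∃ (c c₀ : ℕ) (B₃ a₀ a₁ : ℝ), 2 * (F.L : ℝ) ^ 2 ≤ B₃ ∧ 0 < a₀ ∧ 0 < a₁ ∧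
      Prop8RegSepTopStepG F 2 (fun ν K Ω => suppDomOfRecord F ν K Ω) (fun ν _M _g K k _s => c ≤ ν.M₁ ∧ k + c₀ ≤ F.m + K) B₃ a₀ a₁)
    (hK : ∀ (F : T4Family) (a₀ : ℝ), 0 < a₀ → ∃ (j : ℕ) (ε₀ ε₂₉ B₃ B₃' a₁ : ℝ), 0 < ε₂₉ ∧
      ∃ (ℓ : U3Letters₁₁) (κ C₉ ω : ℝ) (Λ : ℕ → ℕ → ℝ), 0 < κ ∧ 0 ≤ ω ∧ ω < 1 ∧
        NE9 ((objectsOfRecord₁₃ F 2 (theta13OfThm1CCM F 2 j ε₀ ε₂₉ B₃ B₃' a₀ a₁) ℓ).EA 0) (Window (theta13OfThm1CCM F 2 j ε₀ ε₂₉ B₃ B₃' a₀ a₁).γ) κ Λ ∧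
        T4OutputRate.FadingMemory C₉ ω Λ ∧
        KernelDecayOfRecord₁₃ F 2 (theta13OfThm1CCM F 2 j ε₀ ε₂₉ B₃ B₃' a₀ a₁) 0 1 κ) :
    Summit.QuantumFields.YangMills.Theses.BalabanUVNodes.Record13SepCoPHInhabited :=
  record13SepCoPHInhabited_of_stub1G_tokenFree_byName h1G fun F => tokenFree_of_kernelLettersAtOneWitness F (hK F)

/-- **★★ … AND AT ONE SMALL-WINDOW WITNESS `θ₁₅ᶜᶜᴹᵂ(j; γ₀)` PER THRESHOLD** (NE9 read on `Window γ₀`, `0 < γ₀ ≤ ½`; p634760's `tokenFree_of_kernelLettersAtOneWindowWitness`).  CONDITIONAL; K0⁷ OPEN; a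
helper, not a closer. [cite: Balaban1985Variational, Thm 1 (8)–(9) p.279, Prop. 8 p.304, p.304 lines 1–2; Balaban1985RegularSpaces, Prop. 6 p.99; Balaban1988Convergent, Thm 1 p.262; Balaban1987RG1, Thm 1 p.255, (1.18) p.263, (5.10) p.293; Balaban1989LargeFieldII, (1.4) p.357] -/
theorem record13SepCoPHInhabited_of_stub1G_kernelLettersAtOneWindowWitness_byName
    (h1G : ∀ F : T4Family, ∃ (c c₀ : ℕ) (B₃ a₀ a₁ : ℝ), 2 * (F.L : ℝ) ^ 2 ≤ B₃ ∧ 0 < a₀ ∧ 0 < a₁ ∧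
      Prop8RegSepTopStepG F 2 (fun ν K Ω => suppDomOfRecord F ν K Ω) (fun ν _M _g K k _s => c ≤ ν.M₁ ∧ k + c₀ ≤ F.m + K) B₃ a₀ a₁)
    (hK : ∀ (F : T4Family) (a₀ : ℝ), 0 < a₀ → ∃ (j : ℕ) (γ₀ ε₀ ε₂₉ B₃ B₃' a₁ : ℝ), 0 < γ₀ ∧ γ₀ ≤ 1 / 2 ∧ 0 < ε₂₉ ∧
      ∃ (ℓ : U3Letters₁₁) (κ C₉ ω : ℝ) (Λ : ℕ → ℕ → ℝ), 0 < κ ∧ 0 ≤ ω ∧ ω < 1 ∧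
        NE9 ((objectsOfRecord₁₃ F 2 (theta13OfThm1CCMW F 2 j γ₀ ε₀ ε₂₉ B₃ B₃' a₀ a₁) ℓ).EA 0) (Window (theta13OfThm1CCMW F 2 j γ₀ ε₀ ε₂₉ B₃ B₃' a₀ a₁).γ) κ Λ ∧
        T4OutputRate.FadingMemory C₉ ω Λ ∧
        KernelDecayOfRecord₁₃ F 2 (theta13OfThm1CCMW F 2 j γ₀ ε₀ ε₂₉ B₃ B₃' a₀ a₁) 0 1 κ) :
    Summit.QuantumFields.YangMills.Theses.BalabanUVNodes.Record13SepCoPHInhabited :=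
  record13SepCoPHInhabited_of_stub1G_tokenFree_byName h1G fun F => tokenFree_of_kernelLettersAtOneWindowWitness F (hK F)

/-- **★★ K0⁷ BY NAME FROM THE V20-G STUB-1 TEXT AND THE WINDOW-UNIFORM (5.10) BILL AT ONE WITNESS PER THRESHOLD** ([I] (5.10) for the limiting kernels on `Window γ₀`, one `(C, δ₁)`; p608074's
currency, p634760's `tokenFree_of_kernelDecayWindowUniformAtOneWitness`).  CONDITIONAL; K0⁷ OPEN; a helper, not a closer.
[cite: Balaban1985Variational, Thm 1 (8)–(9) p.279, Prop. 8 p.304, p.304 lines 1–2; Balaban1985RegularSpaces, Prop. 6 p.99; Balaban1988Convergent, Thm 1 p.262; Balaban1987RG1, Thm 1 p.259, §1 p.264, (5.10) p.293] -/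
theorem record13SepCoPHInhabited_of_stub1G_kernelDecayWindowUniformAtOneWitness_byName
    (h1G : ∀ F : T4Family, ∃ (c c₀ : ℕ) (B₃ a₀ a₁ : ℝ), 2 * (F.L : ℝ) ^ 2 ≤ B₃ ∧ 0 < a₀ ∧ 0 < a₁ ∧
      Prop8RegSepTopStepG F 2 (fun ν K Ω => suppDomOfRecord F ν K Ω) (fun ν _M _g K k _s => c ≤ ν.M₁ ∧ k + c₀ ≤ F.m + K) B₃ a₀ a₁)
    (hdec : ∀ (F : T4Family) (a₀ : ℝ), 0 < a₀ → ∃ (j : ℕ) (ε₀ ε₂₉ B₃ B₃' a₁ : ℝ), 0 < ε₂₉ ∧ ∃ γ₀ C δ₁ : ℝ, 0 < γ₀ ∧ γ₀ ≤ 1 / 2 ∧ 0 < δ₁ ∧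
      (letI := (theta13OfThm1CCM F 2 j ε₀ ε₂₉ B₃ B₃' a₀ a₁).instVβ₁; letI := (theta13OfThm1CCM F 2 j ε₀ ε₂₉ B₃ B₃' a₀ a₁).instVβ₂;
       letI := (theta13OfThm1CCM F 2 j ε₀ ε₂₉ B₃ B₃' a₀ a₁).instιβ
       ∀ g ∈ Window γ₀, ∀ k : ℕ,
         Decay510 (kernelA F (mergedTermFamilyMatT F 2 (TβOfRecord₁₃ F 2) (chiβOfRecord₁₃ F 2 (theta13OfThm1CCM F 2 j ε₀ ε₂₉ B₃ B₃' a₀ a₁))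
           (theta13OfThm1CCM F 2 j ε₀ ε₂₉ B₃ B₃' a₀ a₁).εbg) (theta13OfThm1CCM F 2 j ε₀ ε₂₉ B₃ B₃' a₀ a₁).ρ8 (theta13OfThm1CCM F 2 j ε₀ ε₂₉ B₃ B₃' a₀ a₁).bV g k 0 1) C δ₁)) :
    Summit.QuantumFields.YangMills.Theses.BalabanUVNodes.Record13SepCoPHInhabited :=
  record13SepCoPHInhabited_of_stub1G_tokenFree_byName h1G fun F => tokenFree_of_kernelDecayWindowUniformAtOneWitness F (hdec F)

/-- **★★ K0⁷ BY NAME FROM THE V20-G STUB-1 TEXT AND THE FUNDAMENTAL-DOMAIN BILL AT ONE WITNESS PER THRESHOLD** ((L) `PolLimitsExistBox` + (FD) one `(C, δ₁)` on the centred fundamental window of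
every torus; p613354's currency, p634760's `tokenFree_of_fundamentalDomainFaceAtOneWitness`).  CONDITIONAL; K0⁷ OPEN; a helper, not a closer.
[cite: Balaban1985Variational, Thm 1 (8)–(9) p.279, Prop. 8 p.304, p.304 lines 1–2; Balaban1985RegularSpaces, Prop. 6 p.99; Balaban1988Convergent, Thm 1 p.262; Balaban1987RG1, Thm 1 p.259, §1 p.264, (5.10) p.293] -/
theorem record13SepCoPHInhabited_of_stub1G_fundamentalDomainFaceAtOneWitness_byName
    (h1G : ∀ F : T4Family, ∃ (c c₀ : ℕ) (B₃ a₀ a₁ : ℝ), 2 * (F.L : ℝ) ^ 2 ≤ B₃ ∧ 0 < a₀ ∧ 0 < a₁ ∧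
      Prop8RegSepTopStepG F 2 (fun ν K Ω => suppDomOfRecord F ν K Ω) (fun ν _M _g K k _s => c ≤ ν.M₁ ∧ k + c₀ ≤ F.m + K) B₃ a₀ a₁)
    (h : ∀ (F : T4Family) (a₀ : ℝ), 0 < a₀ → ∃ (j : ℕ) (ε₀ ε₂₉ B₃ B₃' a₁ : ℝ), 0 < ε₂₉ ∧ ∃ γ₀ C δ₁ : ℝ, 0 < γ₀ ∧ γ₀ ≤ 1 / 2 ∧ 0 < δ₁ ∧
      (letI := (theta13OfThm1CCM F 2 j ε₀ ε₂₉ B₃ B₃' a₀ a₁).instVβ₁; letI := (theta13OfThm1CCM F 2 j ε₀ ε₂₉ B₃ B₃' a₀ a₁).instVβ₂;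
       letI := (theta13OfThm1CCM F 2 j ε₀ ε₂₉ B₃ B₃' a₀ a₁).instιβ
       PolLimitsExistBox F
          (mergedTermFamilyMatT F 2 (TβOfRecord₁₃ F 2) (chiβOfRecord₁₃ F 2 (theta13OfThm1CCM F 2 j ε₀ ε₂₉ B₃ B₃' a₀ a₁)) (theta13OfThm1CCM F 2 j ε₀ ε₂₉ B₃ B₃' a₀ a₁).εbg)
          (theta13OfThm1CCM F 2 j ε₀ ε₂₉ B₃ B₃' a₀ a₁).ρ8 (theta13OfThm1CCM F 2 j ε₀ ε₂₉ B₃ B₃' a₀ a₁).bV γ₀ ∧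
       (∀ k (v : Fin (k + 1) → ℝ), v ∈ Box γ₀ k → ∀ K (z : Fin 4 → ℤ), (∀ i, 2 * |z i| < ((F.P K).sitesPerDir (k + 1) : ℤ)) →
          |polWindow F K (k + 1)
              (mergedTermFamilyMatT F 2 (TβOfRecord₁₃ F 2) (chiβOfRecord₁₃ F 2 (theta13OfThm1CCM F 2 j ε₀ ε₂₉ B₃ B₃' a₀ a₁)) (theta13OfThm1CCM F 2 j ε₀ ε₂₉ B₃ B₃' a₀ a₁).εbg k v K)
              (theta13OfThm1CCM F 2 j ε₀ ε₂₉ B₃ B₃' a₀ a₁).ρ8 (theta13OfThm1CCM F 2 j ε₀ ε₂₉ B₃ B₃' a₀ a₁).bV 0 1 z| ≤ C * Real.exp (-δ₁ * l1 z)))) :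
    Summit.QuantumFields.YangMills.Theses.BalabanUVNodes.Record13SepCoPHInhabited :=
  record13SepCoPHInhabited_of_stub1G_tokenFree_byName h1G fun F => tokenFree_of_fundamentalDomainFaceAtOneWitness F (h F)

end Currencies

/-! ## §4  The ⁷ K0 body at a guarded cube letter `(L^j, c, c₀)` from ONE run letter ∕ ONE comparability letter of `θ₁₅ᶜᶜᴹ(j)` -/

section GBody

/-- **★ THE ⁷ K0 BODY FOR `F` AT `(L^j, c, c₀)`, `c ≤ L^j`, `c₀ ≤ j + 1`, FROM THE GUARDED (8), THE GUARDED (9)-TOKEN AND ONE RUN-WISE LETTER** — p607023 §3's `clausesH_of_runAbsBox` (token-free) gives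
(hcomp) ∧ (hcompRev) at `θ₁₅ᶜᶜᴹᵂ(j; γ)`, then k0-s1-w3 g7's G closer (p635083).  CONDITIONAL. [cite: Balaban1985Variational, Thm 1 (8)–(9) p.279, (144)–(152) pp.300–301, Prop. 8 p.304, p.304 lines 1–2; Balaban1988Convergent, Thm 1 p.262, (2.6)–(2.8) pp.255–256, p.257, (2.21) p.258; Balaban1987RG1, Thm 1 p.259, (1.12) p.262, Thm 3 p.264, (0.1) p.251] -/
theorem exists_k0H_of_thm1CoP7MG_of_gauge9G_of_runAbsBox (F : T4Family) {j c c₀ : ℕ} (hc : c ≤ F.L ^ j) (hc₀ : c₀ ≤ j + 1) {B₃ B₉ a₀ a₁ : ℝ} (hB₃ : 0 ≤ B₃) (hB₉ : 0 ≤ B₉)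
    (ha₀ : 0 < a₀) (ha₁ : 0 < a₁) (h15 : VariationalThm1RegSepCoP7MG F 2 (fun ν _M _g K k _s => c ≤ ν.M₁ ∧ k + c₀ ≤ F.m + K) B₃ a₀ a₁)
    (h9 : Gauge9RegSepTopStepG F 2 (fun ν K Ω => suppDomOfRecord F ν K Ω) (F.L ^ j) (fun ν _M _g K k _s => c ≤ ν.M₁ ∧ k + c₀ ≤ F.m + K) B₃ B₉ a₀ a₁)
    (h3R : ∃ γ₀ ε₀ ε₂₉ β' : ℝ, 0 < γ₀ ∧ 0 < ε₀ ∧ 0 < ε₂₉ ∧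
        RunConstRemainder (betaOfRecord₁₃ F 2 (theta13OfThm1CCM F 2 j ε₀ ε₂₉ B₃ B₉ a₀ a₁)) (fun _ => 0) β' γ₀) :
    ∃ θ : Stage13HParams F 2, θ.Provisos₁₃SepCoPH F 2 ∧ (θ.ZhUnity F 2 ∧ θ.SlotsNondegenerate₁₃ F 2) ∧ θ.Admissible F 2 := by
  obtain ⟨γ, ε₀, ε₂₉, hγ0, hγ, hε, hε', hcomp, hcompRev⟩ := clausesH_of_runAbsBox F j hB₃ hB₉ ha₀.le ha₁.le h3R
  exact exists_k0SepCoPH_thm1CCMW_of_thm1RegSepCoP7MG_of_gauge9TopStepG_of_hcomp_allTorus F hγ0 hγ hε hε' hB₃ hB₉ ha₀ ha₁ hc hc₀ h15 h9 hcomp hcompRev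

/-- **★ THE ⁷ K0 BODY FOR `F` AT `(L^j, c, c₀)` FROM THE GUARDED (8), THE GUARDED (9)-TOKEN AND ONE COMPARABILITY LETTER** (p609606 §3's `clausesH_of_twoComparable` — NO β-value read — then the
G closer).  CONDITIONAL. [cite: Balaban1985Variational, Thm 1 (8)–(9) p.279, (144)–(152) pp.300–301, Prop. 8 p.304, p.304 lines 1–2; Balaban1988Convergent, Thm 1 p.262, (2.4)–(2.8) pp.255–256, p.257, (2.21) p.258; Balaban1987RG1, Thm 1 p.259, (1.12) p.262, (0.20) p.256, (0.1) p.251] -/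
theorem exists_k0H_of_thm1CoP7MG_of_gauge9G_of_twoComparable (F : T4Family) {j c c₀ : ℕ} (hc : c ≤ F.L ^ j) (hc₀ : c₀ ≤ j + 1) {B₃ B₉ a₀ a₁ : ℝ} (hB₃ : 0 ≤ B₃) (hB₉ : 0 ≤ B₉)
    (ha₀ : 0 < a₀) (ha₁ : 0 < a₁) (h15 : VariationalThm1RegSepCoP7MG F 2 (fun ν _M _g K k _s => c ≤ ν.M₁ ∧ k + c₀ ≤ F.m + K) B₃ a₀ a₁)
    (h9 : Gauge9RegSepTopStepG F 2 (fun ν K Ω => suppDomOfRecord F ν K Ω) (F.L ^ j) (fun ν _M _g K k _s => c ≤ ν.M₁ ∧ k + c₀ ≤ F.m + K) B₃ B₉ a₀ a₁)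
    (h3C : ∃ γ₀ ε₀ ε₂₉ : ℝ, 0 < γ₀ ∧ 0 < ε₀ ∧ 0 < ε₂₉ ∧
        ∀ (n : ℕ) (gs : ℕ → ℝ), RGEqH n (betaOfRecord₁₃ F 2 (theta13OfThm1CCM F 2 j ε₀ ε₂₉ B₃ B₉ a₀ a₁)) gs → Step.InInterval γ₀ n gs →
          ∀ m, m < n → gs m ≤ 2 * gs (m + 1) ∧ gs (m + 1) ≤ 2 * gs m) :
    ∃ θ : Stage13HParams F 2, θ.Provisos₁₃SepCoPH F 2 ∧ (θ.ZhUnity F 2 ∧ θ.SlotsNondegenerate₁₃ F 2) ∧ θ.Admissible F 2 := by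
  obtain ⟨γ, ε₀, ε₂₉, hγ0, hγ, hε, hε', hcomp, hcompRev⟩ := clausesH_of_twoComparable F j hB₃ hB₉ ha₀.le ha₁.le h3C
  exact exists_k0SepCoPH_thm1CCMW_of_thm1RegSepCoP7MG_of_gauge9TopStepG_of_hcomp_allTorus F hγ0 hγ hε hε' hB₃ hB₉ ha₀ ha₁ hc hc₀ h15 h9 hcomp hcompRev

end GBody

/-! ## §5  The guarded-supplier compositions: V20-G's stub 1 + a generic guarded (9)-supplier + 3ᴿ-G♭ ∕ 3ᶜ-G♭ ⟹ K0⁷'s body at every family -/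

section Supplier

/-- **★★ K0⁷'s BODY AT EVERY FAMILY FROM V20-G's STUB 1, A GENERIC GUARDED (9)-SUPPLIER, AND 3ᴿ-G♭** (k0-s1-w3 g7's `record13SepCoPHBody_of_stub1G_of_gauge9SupplierG_of_absBetaBoxAtG`, p635083 §4,
with the box replaced by the run letter): stub 1-G ⇒ the guarded (8) (module 53 `variationalThm1RegSepCoP7MG_of_prop8TopStepG`, ceiling shrunk by `.of_le`, guard refined `(c, c₀) ↦ (c′, c₀)` by `.of_imp`),
`hSG` ⇒ the guarded (9) at `(L^j, c′, c₀)` with `c₀ ≤ j + 1`, `h3RGb` there ⇒ the run letter ⇒ §4.  CONDITIONAL; K0⁷ NOT closed here; nothing of Bałaban asserted.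
[cite: Balaban1985Variational, Thm 1 (8)–(9) p.279, (144)–(152) pp.300–301, Prop. 8 p.304, p.304 lines 1–2; Balaban1985RegularSpaces, (1.3)–(1.6) p.77, Prop. 6 p.99, p.98; Balaban1988Convergent, Thm 1 p.262, (2.6)–(2.8) pp.255–256; Balaban1987RG1, Thm 1 p.259, Thm 3 p.264, (0.1) p.251] -/
theorem record13SepCoPHBody_of_stub1G_of_gauge9SupplierG_of_run3RGb
    (h1G : ∀ F : T4Family, ∃ (c c₀ : ℕ) (B₃ a₀ a₁ : ℝ), 2 * (F.L : ℝ) ^ 2 ≤ B₃ ∧ 0 < a₀ ∧ 0 < a₁ ∧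
      Prop8RegSepTopStepG F 2 (fun ν K Ω => suppDomOfRecord F ν K Ω) (fun ν _M _g K k _s => c ≤ ν.M₁ ∧ k + c₀ ≤ F.m + K) B₃ a₀ a₁)
    (hSG : ∀ (F : T4Family) (c c₀ : ℕ) (B₃ a₀ a₁ : ℝ), 2 * (F.L : ℝ) ^ 2 ≤ B₃ → 0 < a₀ → 0 < a₁ →
      Prop8RegSepTopStepG F 2 (fun ν K Ω => suppDomOfRecord F ν K Ω) (fun ν _M _g K k _s => c ≤ ν.M₁ ∧ k + c₀ ≤ F.m + K) B₃ a₀ a₁ →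
      ∃ (j c' : ℕ) (B₉ a₁' : ℝ), c ≤ c' ∧ c' ≤ F.L ^ j ∧ c₀ ≤ j + 1 ∧ 0 < B₉ ∧ 0 < a₁' ∧ a₁' ≤ a₁ ∧
        Gauge9RegSepTopStepG F 2 (fun ν K Ω => suppDomOfRecord F ν K Ω) (F.L ^ j) (fun ν _M _g K k _s => c' ≤ ν.M₁ ∧ k + c₀ ≤ F.m + K) B₃ B₉ a₀ a₁')
    (h3RGb : ∀ (F : T4Family) (j c c₀ : ℕ) (B₃ B₃' a₀ a₁ : ℝ), c ≤ F.L ^ j → c₀ ≤ j + 1 → 2 * (F.L : ℝ) ^ 2 ≤ B₃ → 0 < B₃' → 0 < a₀ → 0 < a₁ →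
      VariationalThm1RegSepCoP7MG F 2 (fun ν _M _g K k _s => c ≤ ν.M₁ ∧ k + c₀ ≤ F.m + K) B₃ a₀ a₁ →
      Gauge9RegSepTopStepG F 2 (fun ν K Ω => suppDomOfRecord F ν K Ω) (F.L ^ j) (fun ν _M _g K k _s => c ≤ ν.M₁ ∧ k + c₀ ≤ F.m + K) B₃ B₃' a₀ a₁ →
      ∃ γ₀ ε₀ ε₂₉ β' : ℝ, 0 < γ₀ ∧ 0 < ε₀ ∧ 0 < ε₂₉ ∧
        RunConstRemainder (betaOfRecord₁₃ F 2 (theta13OfThm1CCM F 2 j ε₀ ε₂₉ B₃ B₃' a₀ a₁)) (fun _ => 0) β' γ₀) :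
    ∀ F : T4Family, ∃ θ : Stage13HParams F 2, θ.Provisos₁₃SepCoPH F 2 ∧ (θ.ZhUnity F 2 ∧ θ.SlotsNondegenerate₁₃ F 2) ∧ θ.Admissible F 2 := by
  intro F
  obtain ⟨c, c₀, B₃, a₀, a₁, hB₃, ha₀, ha₁, h8⟩ := h1G F
  have hL : (0 : ℝ) < (F.L : ℝ) := by exact_mod_cast lt_trans Nat.zero_lt_one F.hL.2
  have hBpos : (0 : ℝ) < B₃ := lt_of_lt_of_le (mul_pos two_pos (pow_pos hL 2)) hB₃
  obtain ⟨j, c', B₉, a₁', hcc', hc', hc₀, hB₉, ha₁', ha₁'le, h9⟩ := hSG F c c₀ B₃ a₀ a₁ hB₃ ha₀ ha₁ h8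
  have h15 : VariationalThm1RegSepCoP7MG F 2 (fun ν _M _g K k _s => c' ≤ ν.M₁ ∧ k + c₀ ≤ F.m + K) B₃ a₀ a₁' :=
    (variationalThm1RegSepCoP7MG_of_prop8TopStepG hBpos (h8.of_le le_rfl ha₁'le)).of_imp fun _ _ _ _ _ _ h => ⟨hcc'.trans h.1, h.2⟩
  exact exists_k0H_of_thm1CoP7MG_of_gauge9G_of_runAbsBox F hc' hc₀ hBpos.le hB₉.le ha₀ ha₁' h15 h9
    (h3RGb F j c' c₀ B₃ B₉ a₀ a₁' hc' hc₀ hB₃ hB₉ ha₀ ha₁' h15 h9)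

/-- **★★ K0⁷'s BODY AT EVERY FAMILY FROM V20-G's STUB 1, A GENERIC GUARDED (9)-SUPPLIER, AND 3ᶜ-G♭** (the same composition with the comparability letter).  CONDITIONAL; K0⁷ NOT closed here.
[cite: Balaban1985Variational, Thm 1 (8)–(9) p.279, (144)–(152) pp.300–301, Prop. 8 p.304, p.304 lines 1–2; Balaban1985RegularSpaces, (1.3)–(1.6) p.77, Prop. 6 p.99, p.98; Balaban1988Convergent, Thm 1 p.262, (2.4)–(2.8) pp.255–256; Balaban1987RG1, Thm 1 p.259, (0.20) p.256, (0.1) p.251] -/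
theorem record13SepCoPHBody_of_stub1G_of_gauge9SupplierG_of_comp3CGb
    (h1G : ∀ F : T4Family, ∃ (c c₀ : ℕ) (B₃ a₀ a₁ : ℝ), 2 * (F.L : ℝ) ^ 2 ≤ B₃ ∧ 0 < a₀ ∧ 0 < a₁ ∧
      Prop8RegSepTopStepG F 2 (fun ν K Ω => suppDomOfRecord F ν K Ω) (fun ν _M _g K k _s => c ≤ ν.M₁ ∧ k + c₀ ≤ F.m + K) B₃ a₀ a₁)
    (hSG : ∀ (F : T4Family) (c c₀ : ℕ) (B₃ a₀ a₁ : ℝ), 2 * (F.L : ℝ) ^ 2 ≤ B₃ → 0 < a₀ → 0 < a₁ →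
      Prop8RegSepTopStepG F 2 (fun ν K Ω => suppDomOfRecord F ν K Ω) (fun ν _M _g K k _s => c ≤ ν.M₁ ∧ k + c₀ ≤ F.m + K) B₃ a₀ a₁ →
      ∃ (j c' : ℕ) (B₉ a₁' : ℝ), c ≤ c' ∧ c' ≤ F.L ^ j ∧ c₀ ≤ j + 1 ∧ 0 < B₉ ∧ 0 < a₁' ∧ a₁' ≤ a₁ ∧
        Gauge9RegSepTopStepG F 2 (fun ν K Ω => suppDomOfRecord F ν K Ω) (F.L ^ j) (fun ν _M _g K k _s => c' ≤ ν.M₁ ∧ k + c₀ ≤ F.m + K) B₃ B₉ a₀ a₁')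
    (h3CGb : ∀ (F : T4Family) (j c c₀ : ℕ) (B₃ B₃' a₀ a₁ : ℝ), c ≤ F.L ^ j → c₀ ≤ j + 1 → 2 * (F.L : ℝ) ^ 2 ≤ B₃ → 0 < B₃' → 0 < a₀ → 0 < a₁ →
      VariationalThm1RegSepCoP7MG F 2 (fun ν _M _g K k _s => c ≤ ν.M₁ ∧ k + c₀ ≤ F.m + K) B₃ a₀ a₁ →
      Gauge9RegSepTopStepG F 2 (fun ν K Ω => suppDomOfRecord F ν K Ω) (F.L ^ j) (fun ν _M _g K k _s => c ≤ ν.M₁ ∧ k + c₀ ≤ F.m + K) B₃ B₃' a₀ a₁ →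
      ∃ γ₀ ε₀ ε₂₉ : ℝ, 0 < γ₀ ∧ 0 < ε₀ ∧ 0 < ε₂₉ ∧
        ∀ (n : ℕ) (gs : ℕ → ℝ), RGEqH n (betaOfRecord₁₃ F 2 (theta13OfThm1CCM F 2 j ε₀ ε₂₉ B₃ B₃' a₀ a₁)) gs → Step.InInterval γ₀ n gs →
          ∀ m, m < n → gs m ≤ 2 * gs (m + 1) ∧ gs (m + 1) ≤ 2 * gs m) :
    ∀ F : T4Family, ∃ θ : Stage13HParams F 2, θ.Provisos₁₃SepCoPH F 2 ∧ (θ.ZhUnity F 2 ∧ θ.SlotsNondegenerate₁₃ F 2) ∧ θ.Admissible F 2 := by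
  intro F
  obtain ⟨c, c₀, B₃, a₀, a₁, hB₃, ha₀, ha₁, h8⟩ := h1G F
  have hL : (0 : ℝ) < (F.L : ℝ) := by exact_mod_cast lt_trans Nat.zero_lt_one F.hL.2
  have hBpos : (0 : ℝ) < B₃ := lt_of_lt_of_le (mul_pos two_pos (pow_pos hL 2)) hB₃
  obtain ⟨j, c', B₉, a₁', hcc', hc', hc₀, hB₉, ha₁', ha₁'le, h9⟩ := hSG F c c₀ B₃ a₀ a₁ hB₃ ha₀ ha₁ h8
  have h15 : VariationalThm1RegSepCoP7MG F 2 (fun ν _M _g K k _s => c' ≤ ν.M₁ ∧ k + c₀ ≤ F.m + K) B₃ a₀ a₁' :=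
    (variationalThm1RegSepCoP7MG_of_prop8TopStepG hBpos (h8.of_le le_rfl ha₁'le)).of_imp fun _ _ _ _ _ _ h => ⟨hcc'.trans h.1, h.2⟩
  exact exists_k0H_of_thm1CoP7MG_of_gauge9G_of_twoComparable F hc' hc₀ hBpos.le hB₉.le ha₀ ha₁' h15 h9
    (h3CGb F j c' c₀ B₃ B₉ a₀ a₁' hc' hc₀ hB₃ hB₉ ha₀ ha₁' h15 h9)

end Supplier

/-! ## §6  K0⁷ BY NAME under the V20-G stub-1 text from the run ∕ comparability letters (stub 2′ BY NAME, p595104, through k0-s1-w3 g7's guarded print-cube supplier) -/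

section RunCompByName

/-- **★★★ K0⁷ BY NAME FROM THE V20-G STUB-1 TEXT AND 3ᴿ-G♭** — the print-faithful run letter ([I] Thm 3) under the guarded antecedents.  CONDITIONAL on both texts (displayed, NOT inhabited
here); K0⁷ OPEN; a helper, not a closer. [cite: Balaban1985Variational, Thm 1 (8)–(9) p.279, (144)–(152) pp.300–301, Prop. 8 p.304, p.304 lines 1–2; Balaban1985RegularSpaces, Prop. 6 p.99, p.98; Balaban1988Convergent, Thm 1 p.262, (2.6)–(2.8) pp.255–256; Balaban1987RG1, Thm 1 p.259, Thm 3 p.264, (0.1) p.251; Balaban1989LargeFieldII, p.355] -/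
theorem record13SepCoPHInhabited_of_stub1G_run3RGb_byName
    (h1G : ∀ F : T4Family, ∃ (c c₀ : ℕ) (B₃ a₀ a₁ : ℝ), 2 * (F.L : ℝ) ^ 2 ≤ B₃ ∧ 0 < a₀ ∧ 0 < a₁ ∧
      Prop8RegSepTopStepG F 2 (fun ν K Ω => suppDomOfRecord F ν K Ω) (fun ν _M _g K k _s => c ≤ ν.M₁ ∧ k + c₀ ≤ F.m + K) B₃ a₀ a₁)
    (h3RGb : ∀ (F : T4Family) (j c c₀ : ℕ) (B₃ B₃' a₀ a₁ : ℝ), c ≤ F.L ^ j → c₀ ≤ j + 1 → 2 * (F.L : ℝ) ^ 2 ≤ B₃ → 0 < B₃' → 0 < a₀ → 0 < a₁ →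
      VariationalThm1RegSepCoP7MG F 2 (fun ν _M _g K k _s => c ≤ ν.M₁ ∧ k + c₀ ≤ F.m + K) B₃ a₀ a₁ →
      Gauge9RegSepTopStepG F 2 (fun ν K Ω => suppDomOfRecord F ν K Ω) (F.L ^ j) (fun ν _M _g K k _s => c ≤ ν.M₁ ∧ k + c₀ ≤ F.m + K) B₃ B₃' a₀ a₁ →
      ∃ γ₀ ε₀ ε₂₉ β' : ℝ, 0 < γ₀ ∧ 0 < ε₀ ∧ 0 < ε₂₉ ∧
        RunConstRemainder (betaOfRecord₁₃ F 2 (theta13OfThm1CCM F 2 j ε₀ ε₂₉ B₃ B₃' a₀ a₁)) (fun _ => 0) β' γ₀) :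
    Summit.QuantumFields.YangMills.Theses.BalabanUVNodes.Record13SepCoPHInhabited :=
  record13SepCoPHBody_of_stub1G_of_gauge9SupplierG_of_run3RGb h1G
    (fun F c c₀ B₃ a₀ a₁ hB₃ ha₀ ha₁ h8 => gauge9SupplierG_of_prop6MemberP F (stub_prop6MemberB8AtP13 F) c c₀ B₃ a₀ a₁ hB₃ ha₀ ha₁ h8) h3RGb

/-- **★★★ K0⁷ BY NAME FROM THE V20-G STUB-1 TEXT AND THE TOKEN-FREE RUN CORE** (ONE run letter of `β₁₃(F; a₀, ε₂₉)` per threshold — text-independent; the guarded tokens are ignored).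
CONDITIONAL; K0⁷ OPEN; a helper, not a closer. [cite: Balaban1985Variational, Thm 1 (8)–(9) p.279, Prop. 8 p.304, p.304 lines 1–2; Balaban1985RegularSpaces, Prop. 6 p.99; Balaban1988Convergent, Thm 1 p.262; Balaban1987RG1, Thm 1 p.259, Thm 3 p.264; Balaban1989LargeFieldII, p.355] -/
theorem record13SepCoPHInhabited_of_stub1G_tokenFreeRun_byName
    (h1G : ∀ F : T4Family, ∃ (c c₀ : ℕ) (B₃ a₀ a₁ : ℝ), 2 * (F.L : ℝ) ^ 2 ≤ B₃ ∧ 0 < a₀ ∧ 0 < a₁ ∧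
      Prop8RegSepTopStepG F 2 (fun ν K Ω => suppDomOfRecord F ν K Ω) (fun ν _M _g K k _s => c ≤ ν.M₁ ∧ k + c₀ ≤ F.m + K) B₃ a₀ a₁)
    (hT : ∀ (F : T4Family) (a₀ : ℝ), 0 < a₀ → ∃ γ₀ ε₂₉ β' : ℝ, 0 < γ₀ ∧ 0 < ε₂₉ ∧ ∀ (j : ℕ) (ε₀ B₃ B₃' a₁ : ℝ),
      RunConstRemainder (betaOfRecord₁₃ F 2 (theta13OfThm1CCM F 2 j ε₀ ε₂₉ B₃ B₃' a₀ a₁)) (fun _ => 0) β' γ₀) :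
    Summit.QuantumFields.YangMills.Theses.BalabanUVNodes.Record13SepCoPHInhabited := by
  refine record13SepCoPHInhabited_of_stub1G_run3RGb_byName h1G fun F j c c₀ B₃ B₃' a₀ a₁ _ _ _ _ ha₀ _ _ _ => ?_
  obtain ⟨γ₀, ε₂₉, β', hγ₀, hε', hall⟩ := hT F a₀ ha₀
  exact ⟨γ₀, 1, ε₂₉, β', hγ₀, one_pos, hε', hall j 1 B₃ B₃' a₁⟩

/-- **★★★ K0⁷ BY NAME FROM THE V20-G STUB-1 TEXT AND 3ᶜ-G♭** — the WEAKEST letter (2-comparability along in-window runs; no β value) under the guarded antecedents.  CONDITIONAL on both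
texts; K0⁷ OPEN; a helper, not a closer. [cite: Balaban1985Variational, Thm 1 (8)–(9) p.279, (144)–(152) pp.300–301, Prop. 8 p.304, p.304 lines 1–2; Balaban1985RegularSpaces, Prop. 6 p.99, p.98; Balaban1988Convergent, Thm 1 p.262, (2.4)–(2.8) pp.255–256; Balaban1987RG1, Thm 1 p.259, (0.20) p.256, (0.1) p.251] -/
theorem record13SepCoPHInhabited_of_stub1G_comp3CGb_byName
    (h1G : ∀ F : T4Family, ∃ (c c₀ : ℕ) (B₃ a₀ a₁ : ℝ), 2 * (F.L : ℝ) ^ 2 ≤ B₃ ∧ 0 < a₀ ∧ 0 < a₁ ∧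
      Prop8RegSepTopStepG F 2 (fun ν K Ω => suppDomOfRecord F ν K Ω) (fun ν _M _g K k _s => c ≤ ν.M₁ ∧ k + c₀ ≤ F.m + K) B₃ a₀ a₁)
    (h3CGb : ∀ (F : T4Family) (j c c₀ : ℕ) (B₃ B₃' a₀ a₁ : ℝ), c ≤ F.L ^ j → c₀ ≤ j + 1 → 2 * (F.L : ℝ) ^ 2 ≤ B₃ → 0 < B₃' → 0 < a₀ → 0 < a₁ →
      VariationalThm1RegSepCoP7MG F 2 (fun ν _M _g K k _s => c ≤ ν.M₁ ∧ k + c₀ ≤ F.m + K) B₃ a₀ a₁ →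
      Gauge9RegSepTopStepG F 2 (fun ν K Ω => suppDomOfRecord F ν K Ω) (F.L ^ j) (fun ν _M _g K k _s => c ≤ ν.M₁ ∧ k + c₀ ≤ F.m + K) B₃ B₃' a₀ a₁ →
      ∃ γ₀ ε₀ ε₂₉ : ℝ, 0 < γ₀ ∧ 0 < ε₀ ∧ 0 < ε₂₉ ∧
        ∀ (n : ℕ) (gs : ℕ → ℝ), RGEqH n (betaOfRecord₁₃ F 2 (theta13OfThm1CCM F 2 j ε₀ ε₂₉ B₃ B₃' a₀ a₁)) gs → Step.InInterval γ₀ n gs →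
          ∀ m, m < n → gs m ≤ 2 * gs (m + 1) ∧ gs (m + 1) ≤ 2 * gs m) :
    Summit.QuantumFields.YangMills.Theses.BalabanUVNodes.Record13SepCoPHInhabited :=
  record13SepCoPHBody_of_stub1G_of_gauge9SupplierG_of_comp3CGb h1G
    (fun F c c₀ B₃ a₀ a₁ hB₃ ha₀ ha₁ h8 => gauge9SupplierG_of_prop6MemberP F (stub_prop6MemberB8AtP13 F) c c₀ B₃ a₀ a₁ hB₃ ha₀ ha₁ h8) h3CGb

/-- **★★★ K0⁷ BY NAME FROM THE V20-G STUB-1 TEXT AND THE TOKEN-FREE COMPARABILITY CORE** (ONE comparability letter of `β₁₃(F; a₀, ε₂₉)` per threshold — the weakest text-independent K0 β-bill,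
now under the plan's V20-G stub 1 as under V19 (p609606) and V20-R (p635649)).  CONDITIONAL; K0⁷ OPEN; a helper, not a closer.
[cite: Balaban1985Variational, Thm 1 (8)–(9) p.279, Prop. 8 p.304, p.304 lines 1–2; Balaban1985RegularSpaces, Prop. 6 p.99; Balaban1988Convergent, Thm 1 p.262, (2.4)–(2.8) pp.255–256; Balaban1987RG1, Thm 1 p.259, (0.20) p.256; Balaban1989LargeFieldII, p.355] -/
theorem record13SepCoPHInhabited_of_stub1G_tokenFreeComp_byName
    (h1G : ∀ F : T4Family, ∃ (c c₀ : ℕ) (B₃ a₀ a₁ : ℝ), 2 * (F.L : ℝ) ^ 2 ≤ B₃ ∧ 0 < a₀ ∧ 0 < a₁ ∧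
      Prop8RegSepTopStepG F 2 (fun ν K Ω => suppDomOfRecord F ν K Ω) (fun ν _M _g K k _s => c ≤ ν.M₁ ∧ k + c₀ ≤ F.m + K) B₃ a₀ a₁)
    (hT : ∀ (F : T4Family) (a₀ : ℝ), 0 < a₀ → ∃ γ₀ ε₂₉ : ℝ, 0 < γ₀ ∧ 0 < ε₂₉ ∧ ∀ (j : ℕ) (ε₀ B₃ B₃' a₁ : ℝ),
      ∀ (n : ℕ) (gs : ℕ → ℝ), RGEqH n (betaOfRecord₁₃ F 2 (theta13OfThm1CCM F 2 j ε₀ ε₂₉ B₃ B₃' a₀ a₁)) gs → Step.InInterval γ₀ n gs →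
        ∀ m, m < n → gs m ≤ 2 * gs (m + 1) ∧ gs (m + 1) ≤ 2 * gs m) :
    Summit.QuantumFields.YangMills.Theses.BalabanUVNodes.Record13SepCoPHInhabited := by
  refine record13SepCoPHInhabited_of_stub1G_comp3CGb_byName h1G fun F j c c₀ B₃ B₃' a₀ a₁ _ _ _ _ ha₀ _ _ _ => ?_
  obtain ⟨γ₀, ε₂₉, hγ₀, hε', hall⟩ := hT F a₀ ha₀
  exact ⟨γ₀, 1, ε₂₉, hγ₀, one_pos, hε', hall j 1 B₃ B₃' a₁⟩

end RunCompByName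


end Summit.QuantumFields.YangMills.Theorems.K0Stub3V20GSockets

end
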